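import Summits.Ventures.YMGap.RobustBall.RobustSlabLaw
import HarnessLib

/-!
# Robust ball (Y2), area-law side, part 1b — slab disintegration of a PERTURBED Wilson weight

HONEST FRAMING: venture file of the cell `pub-ymgap` (QuantumFields programme), track ROBUST-BALL. It generalises the
slab disintegration of `DurhuusFrohlichSlabCriterionProofs` (Cao–Nissim–Sheffield arXiv:2509.04688 §2, the «conditioning on
the links orthogonal to the vertical side») from the Wilson weight `exp(-Nβ S_W(U))` to the PERTURBED weight
`exp(-Nβ S_W(U) - W(U))` of part 1a (`RobustSlabLaw`), for an ARBITRARY bounded measurable `W : GaugeConfig (n+1) L (SU N) → ℝ`.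
Finite-torus, strong-coupling bookkeeping only: no statement about area laws, mass gaps or the continuum is made in this file.

Contents: the factorisation `weightW_glue`, the exact disintegration `integral_weightW_mul_eq`
(`∫ e^{-NβS-W} F = ∫_r slabWeightW(r) · E^W_r[F(glue · r)]`), and the conditioning lemma `integral_weightW_mul_mul_eq_slabAvgW`
(a factor living on the slab may be replaced by its perturbed slab expectation `slabAvgW` when the cofactor does not see the slab).

References: Cao–Nissim–Sheffield arXiv:2509.04688v2 §2 (Def. 2.1, proof of Thm. 2.3); Durhuus–Fröhlich CMP 75 (1980).
-/

noncomputable section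

open MeasureTheory
open Literature.MathematicalPhysics.QuantumLattice (fundamentalRep continuous_fundamentalRep fundamentalRep_apply)
open Literature.MathematicalPhysics.QuantumFieldTheory
open Literature.MathematicalPhysics.QuantumFieldTheory.DurhuusFrohlich

namespace Summit.Ventures.YMGap.RobustBall

variable {n L N : ℕ}

section Peel

variable [NeZero L] {W : GaugeConfig (n + 1) L (SU N) → ℝ}


/-- The perturbed weight of a glued configuration factorises: `exp(-Nβ S_rest(r)) exp(-NβN|E|) exp(tilt_r(Q))`. [folklore] -/
theorem weightW_glue (v : Fin (n + 1)) (t : ZMod L) (β : ℝ) (Q : Site n L → SU N)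
    (r : {e : Edge (n + 1) L // ¬ IsSlab v t e} → SU N) :
    weightW N β W (glue v t Q r) =
      Real.exp (-((N : ℝ) * β) * restAction v t (glue v t (fun _ => 1) r)) *
        Real.exp (-((N : ℝ) * β) * ((N : ℝ) * Fintype.card (Edge n L))) *
        Real.exp (slabTiltW v t β W r Q) := by
  rw [weightW_eq_mul, weight, exp_neg_wilsonAction_glue, slabTiltW, slabActionOf_glue, sub_eq_add_neg, Real.exp_add]
  ring

/-- Integration against a tilted measure, un-normalised: `∫ e^{f} g dμ = (∫ e^f dμ) ∫ g d(μ.tilted f)`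
(complex-valued `g`). [folklore] -/
theorem integral_exp_mul_eq_mul_integral_tilted {α : Type*} [MeasurableSpace α] (μ : Measure α)
    (f : α → ℝ) (g : α → ℂ) (hZ : (∫ x, Real.exp (f x) ∂μ) ≠ 0) :
    ∫ x, (Real.exp (f x) : ℂ) * g x ∂μ =
      ((∫ x, Real.exp (f x) ∂μ : ℝ) : ℂ) * ∫ x, g x ∂(μ.tilted f) := by
  rw [integral_tilted, ← integral_const_mul]
  refine integral_congr_ae (ae_of_all _ fun x => ?_)
  simp only [Complex.real_smul, ← mul_assoc, ← Complex.ofReal_mul]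
  congr 2
  field_simp

/-- **The perturbed slab disintegration**: integrating a bounded measurable `F` against the perturbed weight =
integrating over the off-slab links `r`, with weight `slabWeightW r ≥ 0`, the perturbed-slab-law expectation of `F(glue · r)`.
[cite: CaoNissimSheffield2025dynamical, §2] -/
theorem integral_weightW_mul_eq (v : Fin (n + 1)) (t : ZMod L) (β : ℝ) (hWm : Measurable W) (hWb : ∃ C, ∀ U, |W U| ≤ C)
    (F : GaugeConfig (n + 1) L (SU N) → ℂ) (hF : Measurable F) (C : ℝ) (hC : ∀ U, ‖F U‖ ≤ C) :
    ∫ U, (weightW N β W U : ℂ) * F U ∂(linkMeasure n L N) =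
      ∫ r, (slabWeightW v t β W r : ℂ) * ∫ Q, F (glue v t Q r) ∂(slabLawW v t β W r) ∂(restMeasure v t N) := by
  -- (1) transport to the product space
  have hmp := measurePreserving_splitEquiv (n := n) (L := L) v t (haarProbability (SU N))
  have h1 : ∫ U, (weightW N β W U : ℂ) * F U ∂(linkMeasure n L N) =
      ∫ p, (weightW N β W (glue v t p.1 p.2) : ℂ) * F (glue v t p.1 p.2)
        ∂((sliceMeasure n L N).prod (restMeasure v t N)) := by
    rw [← (hmp.symm _).integral_comp']
    rfl
  rw [h1]
  -- (2) Fubini, `r` outside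
  obtain ⟨Cw, hCw⟩ := exists_weightW_le (n := n) (L := L) (N := N) β hWb
  have hint : Integrable (fun p : (Site n L → SU N) × ({e : Edge (n + 1) L // ¬ IsSlab v t e} → SU N) =>
      (weightW N β W (glue v t p.1 p.2) : ℂ) * F (glue v t p.1 p.2))
      ((sliceMeasure n L N).prod (restMeasure v t N)) := by
    refine Integrable.of_bound ?_ (Cw * C) (ae_of_all _ fun p => ?_)
    · refine Measurable.aestronglyMeasurable ?_
      exact ((Complex.measurable_ofReal.comp (measurable_weightW β hWm)).comp (measurable_glue v t)).mul
        (hF.comp (measurable_glue v t))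
    · rw [norm_mul, Complex.norm_real, Real.norm_eq_abs, abs_of_pos (weightW_pos W β _)]
      exact mul_le_mul (hCw _) (hC _) (norm_nonneg _)
        ((weightW_pos W β (glue v t p.1 p.2)).le.trans (hCw (glue v t p.1 p.2)))
  rw [integral_prod_symm _ hint]
  -- (3) the inner integral, for each `r`
  refine integral_congr_ae (ae_of_all _ fun r => ?_)
  simp only [weightW_glue, Complex.ofReal_mul, mul_assoc]
  rw [integral_const_mul, integral_const_mul, slabWeightW, Complex.ofReal_mul, Complex.ofReal_mul, mul_assoc,
    mul_assoc]
  congr 2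
  rw [slabLawW, slabZW]
  exact integral_exp_mul_eq_mul_integral_tilted _ _ _ (slabZW_pos v t β hWm hWb r).ne'

/-- The off-slab weight is non-negative. [folklore] -/
theorem slabWeightW_nonneg (v : Fin (n + 1)) (t : ZMod L) (β : ℝ) (hWm : Measurable W) (hWb : ∃ C, ∀ U, |W U| ≤ C)
    (r : {e : Edge (n + 1) L // ¬ IsSlab v t e} → SU N) : 0 ≤ slabWeightW v t β W r :=
  mul_nonneg (mul_nonneg (Real.exp_pos _).le (Real.exp_pos _).le) (slabZW_pos v t β hWm hWb r).le

/-- Taking `F = 1`: the total perturbed mass is the integral of the off-slab weights. [folklore] -/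
theorem integral_weightW_eq_integral_slabWeightW (v : Fin (n + 1)) (t : ZMod L) (β : ℝ) (hWm : Measurable W)
    (hWb : ∃ C, ∀ U, |W U| ≤ C) :
    ∫ U, (weightW N β W U : ℂ) ∂(linkMeasure n L N) = ∫ r, (slabWeightW v t β W r : ℂ) ∂(restMeasure v t N) := by
  have h := integral_weightW_mul_eq (n := n) (L := L) (N := N) v t β hWm hWb (fun _ => 1) measurable_const 1
    (fun _ => by simp)
  simp only [mul_one] at h
  rw [h]
  refine integral_congr_ae (ae_of_all _ fun r => ?_)
  haveI := isProbabilityMeasure_slabLawW (n := n) (L := L) (N := N) v t β hWm hWb r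
  simp

end Peel

/-! ### Replacing a slab factor by its perturbed slab expectation -/

section SlabAvg

variable [NeZero L] {W : GaugeConfig (n + 1) L (SU N) → ℝ}


variable (W) in
/-- The perturbed slab expectation `E^W_{r}[Ψ(glue · r)]` of an observable, as a function of the off-slab links. [folklore] -/
def slabAvgW (v : Fin (n + 1)) (t : ZMod L) (β : ℝ) (W : GaugeConfig (n + 1) L (SU N) → ℝ)
    (Ψ : GaugeConfig (n + 1) L (SU N) → ℂ) (r : {e : Edge (n + 1) L // ¬ IsSlab v t e} → SU N) : ℂ :=
  ∫ Q, Ψ (glue v t Q r) ∂(slabLawW v t β W r)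

/-- Perturbed slab expectations of bounded observables are bounded. [folklore] -/
theorem norm_slabAvgW_le (v : Fin (n + 1)) (t : ZMod L) (β : ℝ) (hWm : Measurable W) (hWb : ∃ C, ∀ U, |W U| ≤ C)
    {Ψ : GaugeConfig (n + 1) L (SU N) → ℂ} {C : ℝ} (hC : ∀ U, ‖Ψ U‖ ≤ C)
    (r : {e : Edge (n + 1) L // ¬ IsSlab v t e} → SU N) : ‖slabAvgW v t β W Ψ r‖ ≤ C := by
  haveI := isProbabilityMeasure_slabLawW (n := n) (L := L) (N := N) v t β hWm hWb r
  have h := norm_integral_le_of_norm_le_const (μ := slabLawW v t β W r) (f := fun Q => Ψ (glue v t Q r))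
    (ae_of_all _ fun Q => hC _)
  simpa [slabAvgW] using h

/-- The perturbed slab expectation as an un-normalised product-Haar integral. [folklore] -/
theorem slabAvgW_eq (v : Fin (n + 1)) (t : ZMod L) (β : ℝ) (hWm : Measurable W) (hWb : ∃ C, ∀ U, |W U| ≤ C)
    (Ψ : GaugeConfig (n + 1) L (SU N) → ℂ) (r : {e : Edge (n + 1) L // ¬ IsSlab v t e} → SU N) :
    slabAvgW v t β W Ψ r = ((slabZW v t β W r)⁻¹ : ℝ) •
      ∫ Q, (Real.exp (slabTiltW v t β W r Q) : ℂ) * Ψ (glue v t Q r) ∂(sliceMeasure n L N) := by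
  rw [slabAvgW, slabLawW, integral_exp_mul_eq_mul_integral_tilted _ _ _ (slabZW_pos v t β hWm hWb r).ne',
    ← slabZW, Complex.real_smul, ← mul_assoc, ← Complex.ofReal_mul,
    inv_mul_cancel₀ (slabZW_pos v t β hWm hWb r).ne', Complex.ofReal_one, one_mul]

/-- Perturbed slab expectations are measurable in the off-slab links (Fubini measurability). [folklore] -/
theorem measurable_slabAvgW (v : Fin (n + 1)) (t : ZMod L) (β : ℝ) (hWm : Measurable W) (hWb : ∃ C, ∀ U, |W U| ≤ C)
    {Ψ : GaugeConfig (n + 1) L (SU N) → ℂ} (hΨ : Measurable Ψ) : Measurable (slabAvgW v t β W Ψ) := by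
  have hfun : slabAvgW v t β W Ψ = fun r => ((slabZW v t β W r)⁻¹ : ℝ) •
      ∫ Q, (Real.exp (slabTiltW v t β W r Q) : ℂ) * Ψ (glue v t Q r) ∂(sliceMeasure n L N) :=
    funext fun r => slabAvgW_eq v t β hWm hWb Ψ r
  rw [hfun]
  have hE : Measurable fun p : (Site n L → SU N) × ({e : Edge (n + 1) L // ¬ IsSlab v t e} → SU N) =>
      Real.exp (slabTiltW v t β W p.2 p.1) :=
    Real.measurable_exp.comp (measurable_slabTiltW_uncurry v t β hWm)
  have hZ : Measurable (slabZW (n := n) (L := L) (N := N) v t β W) := by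
    have := (hE.stronglyMeasurable).integral_prod_left' (μ := sliceMeasure n L N)
    exact this.measurable
  have hI : Measurable fun r : {e : Edge (n + 1) L // ¬ IsSlab v t e} → SU N =>
      ∫ Q, (Real.exp (slabTiltW v t β W r Q) : ℂ) * Ψ (glue v t Q r) ∂(sliceMeasure n L N) := by
    have hm : Measurable fun p : (Site n L → SU N) × ({e : Edge (n + 1) L // ¬ IsSlab v t e} → SU N) =>
        (Real.exp (slabTiltW v t β W p.2 p.1) : ℂ) * Ψ (glue v t p.1 p.2) :=
      (Complex.measurable_ofReal.comp hE).mul (hΨ.comp (measurable_glue v t))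
    exact ((hm.stronglyMeasurable).integral_prod_left' (μ := sliceMeasure n L N)).measurable
  exact (measurable_inv.comp hZ).smul hI

/-- **Conditioning on the off-slab links** (perturbed version): inside the perturbed integral, a bounded factor `Ψ` may be
replaced by its perturbed slab expectation when the cofactor `G` does not depend on the vertical links of the slab.
[cite: CaoNissimSheffield2025dynamical, §2] -/
theorem integral_weightW_mul_mul_eq_slabAvgW (v : Fin (n + 1)) (t : ZMod L) (β : ℝ) (hWm : Measurable W)
    (hWb : ∃ C, ∀ U, |W U| ≤ C) (G Ψ : GaugeConfig (n + 1) L (SU N) → ℂ) (hG : Measurable G) (hΨ : Measurable Ψ)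
    (CG CΨ : ℝ) (hCG : ∀ U, ‖G U‖ ≤ CG) (hCΨ : ∀ U, ‖Ψ U‖ ≤ CΨ)
    (hGslab : ∀ Q r, G (glue v t Q r) = G (glue v t (fun _ => 1) r)) :
    ∫ U, (weightW N β W U : ℂ) * (G U * Ψ U) ∂(linkMeasure n L N) =
      ∫ U, (weightW N β W U : ℂ) * (G U * slabAvgW v t β W Ψ (restPart v t U)) ∂(linkMeasure n L N) := by
  have hCG0 : 0 ≤ CG := (norm_nonneg _).trans (hCG fun _ => 1)
  have hb1 : ∀ U, ‖G U * Ψ U‖ ≤ CG * CΨ := fun U => by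
    rw [norm_mul]; exact mul_le_mul (hCG U) (hCΨ U) (norm_nonneg _) hCG0
  have hb2 : ∀ U, ‖G U * slabAvgW v t β W Ψ (restPart v t U)‖ ≤ CG * CΨ := fun U => by
    rw [norm_mul]; exact mul_le_mul (hCG U) (norm_slabAvgW_le v t β hWm hWb hCΨ _) (norm_nonneg _) hCG0
  rw [integral_weightW_mul_eq v t β hWm hWb (fun U => G U * Ψ U) (hG.mul hΨ) _ hb1,
    integral_weightW_mul_eq v t β hWm hWb (fun U => G U * slabAvgW v t β W Ψ (restPart v t U))
      (hG.mul ((measurable_slabAvgW v t β hWm hWb hΨ).comp (measurable_restPart v t))) _ hb2]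
  refine integral_congr_ae (ae_of_all _ fun r => ?_)
  haveI := isProbabilityMeasure_slabLawW (n := n) (L := L) (N := N) v t β hWm hWb r
  simp only [hGslab, restPart_glue]
  rw [integral_const_mul, integral_const_mul, integral_const, probReal_univ, one_smul]
  rfl

end SlabAvg


end Summit.Ventures.YMGap.RobustBall
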